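import Literature.AlgebraicGeometry.Frobenioids.ArchimedeanDilationEquivalence
import Literature.AlgebraicGeometry.Frobenioids.ArchimedeanPointBase
import HarnessLib

/-!
# Frobenioids II, Example 3.3 (i)–(ii) / [AbsTopIII] Rmk 5.8.1 (i): the dilations `D_μ` lift to `C = C₀ ×_{D₀} D` over ANY base `D → D₀`,
# in particular to [IUTchI] Ex 3.4 (i)'s `C_v` over the one-morphism base, where they induce `u·r ↦ u·r^μ` on `𝒪^▷(C_v) ≅ 𝒪^▷_ℂ`

S. Mochizuki, *The geometry of Frobenioids II*, Kyushu J. Math. **62** (2008) 401–460, §3, Example 3.3 (i) p. 27 (the category `C₀`: objects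
`(Spec K, V_K, A_K)`, morphisms `(Base(φ), deg_Fr(φ), c)` with (c) «an isomorphism of `L`-vector spaces `V_L^{⊗d} ⥲ V_K|_L` that maps `A_L^{⊗d}` into
`A_K|_L`») and p. 28 (`C := C₀ ×_{D₀} D`, found's categorical fiber product) [cite: MochizukiFrdII2008, Ex 3.3 (i) p.27];
S. Mochizuki, *Topics in absolute anabelian geometry III*, Rmk 5.8.1 (i) p. 142 («the object of 𝕋𝕄⊢ consisting of an isomorph of the topological
monoid `𝒪^▷_ℂ` equipped with the submonoid corresponding to `𝒪^▷_ℂ ∩ ℝ_{>0}`, which is non-rigid, in the sense that it is subject to dilations»)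
[cite: MochizukiAbsTopIII2015, Remark 5.8.1 p.142]; S. Mochizuki, *Inter-universal Teichmüller theory I*, Ex 3.4 (i) p. 80 («by
construction, there is a natural isomorphism `𝒪^▷(𝒞_v) ⥲ 𝒪^▷_{K_v}` of topological monoids») [cite: Mochizuki2012, Ex 3.4 (i) p.80].

## What this file builds (abc-iut cell, row R84 «ARCHDIL» tier (T2-ii); sequel of `ArchimedeanDilationEquivalence` (T2-i); generic [FrdII] §3
## plumbing over abc-iut-L1-t6's `AngularFrobenioidsRelative` / `ArchimedeanPointBase` — no IUT vocabulary)

* §1 **`ArchFrd.C.dilateFunctor π μ : C π ⥤ C π`** for every base `π : D ⥤ D₀` and `μ > 0`: on `C = C₀ ×_{D₀} D` (found's `CFP`) it is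
  `(X, d, ι) ↦ (D_μ X, d, ι)`, `(φ, g, w) ↦ (D_μ φ, g, w)` — legitimate on the nose because `C0.dilateFunctor μ` lies over the IDENTITY of `D₀`
  (`C0.dilateFunctor_comp_baseFunctor`, `rfl`); it lies over the identity of `D` (`dilateFunctor_comp_toBase`, `rfl`) and over `C0.dilateFunctor μ`
  (`dilateFunctor_comp_toC0`, `rfl`); FULL, FAITHFUL, ESSENTIALLY SURJECTIVE, an EQUIVALENCE (`dilateFunctor_isEquivalence`);
* §2 over the one-morphism base ([IUTchI] Ex 3.4 (i), abc-iut-L1-t6's `Cpt`, `std t`, `endEquivUnitDisc`): `(dilateFunctor ptBase μ).obj (std t) = std (t^μ)`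
  (`rfl`); the induced monoid map **`Cpt.dilateEnd μ t : 𝒪^▷(std t) →* 𝒪^▷(std (t^μ))`** (`= Ψ_μ` on base-identity linear endomorphisms) and, through
  the natural isomorphisms `𝒪^▷(std −) ⥲ 𝒪^▷_ℂ`, **`coe_endEquivUnitDisc_dilateEnd`: it is `z ↦ D_μ z = u·r^μ` (`z = u·r`)** — so it carries the
  splitting `(0, 1] = 𝒪^▷_ℂ ∩ ℝ_{>0}` onto itself (`dilateEnd_mem_posReal_iff`) and is bijective (`dilateEnd_bijective`);
* §3 `ArchFrd.unitDisc.dilate μ : 𝒪^▷_ℂ →* 𝒪^▷_ℂ`, the restriction of `D_μ` (bijective), with `endEquivUnitDisc_dilateEnd`;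
* §4 at [IUTchI] Ex 3.4 (i)'s `𝒪^▷(𝒞_v) := 𝒪^▷(std 1)` (`Ψ_μ (std 1) = std (1^μ) = std 1`): **`Cpt.dilateEndOneEquiv μ : 𝒪^▷(std 1) ≃* 𝒪^▷(std 1)`**, `= Ψ_μ` up to
  the retyping `Ψ_μ (std 1) = std 1` (`heq_coe_dilateEndOne`), `= D_μ` through `endEquivUnitDisc 1` (`endEquivUnitDisc_dilateEndOne`), `(0,1] ↦ (0,1]`
  (`dilateEndOne_mem_posReal_iff`) — the handle the L5 consumer (`ArchLocalFrobenioid.ofArchFrd`: `OC = 𝒪^▷(std 1)`, `isoOK = endEquivUnitDisc 1`) calls.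
OURS throughout: print records only that the mono-analytic monoid is «subject to dilations».  Binders: `π`, `μ`, `t`; 0 instance · 0 notation ·
no `Prop` fact.  Classical; nothing here concerns [IUTchIII] Cor. 3.12; no side is taken on any disputed claim.
-/

noncomputable section

namespace Literature.AlgebraicGeometry.Frobenioids

open CategoryTheory

namespace ArchFrd

universe v u

variable {D : Type u} [Category.{v} D] (π : D ⥤ D0)

/-! ### §1. The dilation functor on `C = C₀ ×_{D₀} D` -/

namespace C

/-- **`Ψ_μ` on `C = C₀ ×_{D₀} D`**: `(X, d, ι) ↦ (D_μ X, d, ι)`, `(φ, g, w) ↦ (D_μ φ, g, w)` (bases, base arrows and the compatibility squares are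
unchanged by `D_μ`, so they retype definitionally). [cite: MochizukiFrdII2008, Ex 3.3 (i) p.27] -/
def dilateFunctor (μ : PosReal) : C π ⥤ C π where
  obj X := ⟨C0.dilateObj μ X.fst, X.snd, X.iso⟩
  map f := ⟨C0.dilateHom μ f.fst, f.snd, f.w⟩
  map_id X := CFP.hom_ext ((C0.dilateFunctor μ).map_id X.fst) rfl
  map_comp f g := CFP.hom_ext ((C0.dilateFunctor μ).map_comp f.fst g.fst) rfl

/-- `Ψ_μ` on objects, `C₀`-component. [cite: MochizukiFrdII2008, Ex 3.3 (i) p.27] -/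
@[simp] theorem dilateFunctor_obj_fst (μ : PosReal) (X : C π) : ((dilateFunctor π μ).obj X).fst = C0.dilateObj μ X.fst := rfl

/-- `Ψ_μ` on objects, `D`-component (unchanged). [cite: MochizukiFrdII2008, Ex 3.3 (i) p.27] -/
@[simp] theorem dilateFunctor_obj_snd (μ : PosReal) (X : C π) : ((dilateFunctor π μ).obj X).snd = X.snd := rfl

/-- `Ψ_μ` on morphisms, `C₀`-component. [cite: MochizukiFrdII2008, Ex 3.3 (i) p.27] -/
@[simp] theorem dilateFunctor_map_fst (μ : PosReal) {X Y : C π} (f : X ⟶ Y) : ((dilateFunctor π μ).map f).fst = C0.dilateHom μ f.fst := rfl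

/-- `Ψ_μ` on morphisms, `D`-component (unchanged). [cite: MochizukiFrdII2008, Ex 3.3 (i) p.27] -/
@[simp] theorem dilateFunctor_map_snd (μ : PosReal) {X Y : C π} (f : X ⟶ Y) : ((dilateFunctor π μ).map f).snd = f.snd := rfl

/-- `Ψ_μ` lies over the IDENTITY of the base category `D`. [cite: MochizukiFrdII2008, Ex 3.3 (i) p.27] -/
theorem dilateFunctor_comp_toBase (μ : PosReal) : dilateFunctor π μ ⋙ toBase π = toBase π := rfl

/-- `Ψ_μ` lies over the dilation functor of `C₀`. [cite: MochizukiFrdII2008, Ex 3.3 (i) p.27] -/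
theorem dilateFunctor_comp_toC0 (μ : PosReal) : dilateFunctor π μ ⋙ toC0 π = toC0 π ⋙ C0.dilateFunctor μ := rfl

/-- `Ψ_μ` does not change Frobenius degrees. [cite: MochizukiFrdII2008, Ex 3.3 (i) p.27] -/
theorem degFr_dilateFunctor_map (μ : PosReal) {X Y : C π} (f : X ⟶ Y) :
    PreFrobenioid.degFr (toElem π) ((dilateFunctor π μ).map f) = PreFrobenioid.degFr (toElem π) f := rfl

/-- `Ψ_μ ∘ Ψ_{1/μ} = id` on objects. [cite: MochizukiFrdII2008, Ex 3.3 (i) p.27] -/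
theorem dilateFunctor_obj_dilateFunctor_inv_obj (μ : PosReal) (Y : C π) : (dilateFunctor π μ).obj ((dilateFunctor π μ⁻¹).obj Y) = Y := by
  obtain ⟨A, d, ι⟩ := Y
  change (⟨C0.dilateObj μ (C0.dilateObj μ⁻¹ A), d, ι⟩ : C π) = ⟨A, d, ι⟩
  congr 1
  · exact C0.dilateObj_dilateObj_inv μ A

/-- `Ψ_μ` is FAITHFUL. [cite: MochizukiFrdII2008, Ex 3.3 (i) p.27] -/
theorem dilateFunctor_faithful (μ : PosReal) : (dilateFunctor π μ).Faithful :=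
  haveI := C0.dilateFunctor_faithful μ
  { map_injective := fun {X Y} f g h => by
      have h₁ : ((dilateFunctor π μ).map f).fst = ((dilateFunctor π μ).map g).fst := congrArg CFP.Hom.fst h
      have h₂ : ((dilateFunctor π μ).map f).snd = ((dilateFunctor π μ).map g).snd := congrArg CFP.Hom.snd h
      exact CFP.hom_ext ((C0.dilateFunctor μ).map_injective h₁) h₂ }

/-- `Ψ_μ` is FULL (the `C₀`-component of a morphism between dilated objects descends along the full functor `C0.dilateFunctor μ`; its base arrow,
hence the compatibility square, is unchanged). [cite: MochizukiFrdII2008, Ex 3.3 (i) p.27] -/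
theorem dilateFunctor_full (μ : PosReal) : (dilateFunctor π μ).Full :=
  haveI := C0.dilateFunctor_full μ
  { map_surjective := fun {X Y} χ => by
      have hB : C0.Base ((C0.dilateFunctor μ).preimage χ.fst) = C0.Base (C0.dilateHom μ ((C0.dilateFunctor μ).preimage χ.fst)) := rfl
      refine ⟨⟨(C0.dilateFunctor μ).preimage χ.fst, χ.snd, ?_⟩, CFP.hom_ext ((C0.dilateFunctor μ).map_preimage χ.fst) rfl⟩
      have w := χ.w
      change C0.Base ((C0.dilateFunctor μ).preimage χ.fst) ≫ Y.iso.hom = X.iso.hom ≫ π.map χ.snd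
      rw [hB]
      change C0.Base ((C0.dilateFunctor μ).map ((C0.dilateFunctor μ).preimage χ.fst)) ≫ Y.iso.hom = X.iso.hom ≫ π.map χ.snd
      rw [(C0.dilateFunctor μ).map_preimage χ.fst]
      exact w }

/-- `Ψ_μ` is ESSENTIALLY SURJECTIVE (`Ψ_μ (Ψ_{1/μ} Y) = Y`). [cite: MochizukiFrdII2008, Ex 3.3 (i) p.27] -/
theorem dilateFunctor_essSurj (μ : PosReal) : (dilateFunctor π μ).EssSurj where
  mem_essImage Y := ⟨(dilateFunctor π μ⁻¹).obj Y, ⟨eqToIso (dilateFunctor_obj_dilateFunctor_inv_obj π μ Y)⟩⟩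

/-- **`Ψ_μ` is a self-EQUIVALENCE of `C = C₀ ×_{D₀} D` lying over the identity of `D`**, for every `μ > 0` (OURS).
[cite: MochizukiFrdII2008, Ex 3.3 (i) p.27] -/
theorem dilateFunctor_isEquivalence (μ : PosReal) : (dilateFunctor π μ).IsEquivalence :=
  haveI := dilateFunctor_faithful π μ
  haveI := dilateFunctor_full π μ
  haveI := dilateFunctor_essSurj π μ
  { }

end C

/-! ### §2. Over the one-morphism base: the induced map on `𝒪^▷(std t)` -/

namespace Cpt

/-- `Ψ_μ (std t) = std (t^μ)` on the nose. [cite: Mochizuki2012, Ex 3.4 (i) p.80] -/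
theorem dilateFunctor_obj_std (μ t : PosReal) : (C.dilateFunctor ptBase μ).obj (std t) = std (PosReal.rpowEquiv μ t) := rfl

/-- `Ψ_μ` maps base-identity linear endomorphisms of `std t` to base-identity linear endomorphisms of `std (t^μ)`.
[cite: MochizukiFrdI2008, Def. 1.2(ii)] -/
theorem dilateFunctor_map_mem_endSubmonoid (μ : PosReal) {t : PosReal} {φ : End (std t)}
    (hφ : φ ∈ PreFrobenioid.endSubmonoid (C.toElem ptBase) (std t)) :
    (show End (std (PosReal.rpowEquiv μ t)) from (C.dilateFunctor ptBase μ).map φ) ∈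
      PreFrobenioid.endSubmonoid (C.toElem ptBase) (std (PosReal.rpowEquiv μ t)) :=
  ⟨hφ.1, hφ.2⟩

/-- **The monoid map `𝒪^▷(std t) → 𝒪^▷(std (t^μ))` induced by `Ψ_μ`** (`φ ↦ Ψ_μ φ`). [cite: Mochizuki2012, Ex 3.4 (i) p.80] -/
def dilateEnd (μ t : PosReal) :
    PreFrobenioid.endSubmonoid (C.toElem ptBase) (std t) →* PreFrobenioid.endSubmonoid (C.toElem ptBase) (std (PosReal.rpowEquiv μ t)) where
  toFun φ := ⟨(C.dilateFunctor ptBase μ).map φ.1, dilateFunctor_map_mem_endSubmonoid μ φ.2⟩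
  map_one' := Subtype.ext ((C.dilateFunctor ptBase μ).map_id (std t))
  map_mul' φ ψ := Subtype.ext ((C.dilateFunctor ptBase μ).map_comp (ψ.1 : std t ⟶ std t) (φ.1 : std t ⟶ std t))

/-- `dilateEnd` is `Ψ_μ` on the underlying arrows. [cite: Mochizuki2012, Ex 3.4 (i) p.80] -/
theorem coe_dilateEnd (μ t : PosReal) (φ : PreFrobenioid.endSubmonoid (C.toElem ptBase) (std t)) :
    ((dilateEnd μ t φ : PreFrobenioid.endSubmonoid (C.toElem ptBase) (std (PosReal.rpowEquiv μ t))) : End (std (PosReal.rpowEquiv μ t))) =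
      (C.dilateFunctor ptBase μ).map (φ.1 : std t ⟶ std t) := rfl

/-- **Through the natural isomorphisms `𝒪^▷(std −) ⥲ 𝒪^▷_ℂ` (the scalar), the map induced by `Ψ_μ` is the dilation `D_μ : z ↦ z·|z|^{μ-1}`.**
[cite: Mochizuki2012, Ex 3.4 (i) p.80] -/
theorem coe_endEquivUnitDisc_dilateEnd (μ t : PosReal) (φ : PreFrobenioid.endSubmonoid (C.toElem ptBase) (std t)) :
    ((endEquivUnitDisc (PosReal.rpowEquiv μ t) (dilateEnd μ t φ) : unitDisc) : ℂ) =
      ((dilate μ (C0.scalar (φ.1 : std t ⟶ std t).fst) : ℂˣ) : ℂ) := rfl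

/-- The same in polar form: `u·r ↦ u·r^μ`. [cite: MochizukiAbsTopIII2015, Remark 5.8.1 p.142] -/
theorem coe_endEquivUnitDisc_dilateEnd_polar (μ t : PosReal) (φ : PreFrobenioid.endSubmonoid (C.toElem ptBase) (std t)) :
    ((endEquivUnitDisc (PosReal.rpowEquiv μ t) (dilateEnd μ t φ) : unitDisc) : ℂ) =
      (((unitPart ℂ (C0.scalar (φ.1 : std t ⟶ std t).fst) : normOneSubgroup ℂ) : ℂˣ) : ℂ) *
        ((‖((endEquivUnitDisc t φ : unitDisc) : ℂ)‖) ^ (μ : ℝ) : ℝ) := by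
  rw [coe_endEquivUnitDisc_dilateEnd, dilate_apply, Units.val_mul, coe_ofPosReal, PosReal.coe_rpowEquiv, coe_absHom, coe_endEquivUnitDisc]
  rfl

end Cpt

/-! ### §3. `D_μ` on `𝒪^▷_ℂ` and the splitting `(0, 1]` -/

namespace unitDisc

/-- The unit part of a positive real is trivial. [cite: MochizukiFrdII2008, Def 3.1 (ii) p.23] -/
theorem unitPart_ofPosReal (x : PosReal) : unitPart ℂ (ofPosReal ℂ x) = 1 :=
  Subtype.ext (by
    change ofPosReal ℂ x * (ofPosReal ℂ (absHom ℂ (ofPosReal ℂ x)))⁻¹ = 1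
    rw [absHom_ofPosReal, mul_inv_cancel])

/-- The norm of `D_μ z` is `|z|^μ`. [cite: MochizukiFrdII2008, Def 3.1 (ii) p.23] -/
theorem norm_dilate (μ : PosReal) (u : ℂˣ) : ‖((dilate μ u : ℂˣ) : ℂ)‖ = ‖(u : ℂ)‖ ^ (μ : ℝ) := by
  rw [← coe_absHom, absHom_dilate, PosReal.coe_rpowEquiv, coe_absHom]

/-- `D_μ` preserves `𝒪^▷_ℂ = {0 < |z| ≤ 1}`. [cite: Mochizuki2012, Ex 3.4 (i) p.80] -/
theorem dilate_mem (μ : PosReal) {u : ℂˣ} (hu : (u : ℂ) ∈ unitDisc) : ((dilate μ u : ℂˣ) : ℂ) ∈ unitDisc :=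
  ⟨(dilate μ u).ne_zero, by rw [norm_dilate]; exact Real.rpow_le_one (norm_nonneg _) hu.2 μ.2.le⟩

/-- **`D_μ` on `𝒪^▷_ℂ`** as a multiplicative self-map (an equivalence: `dilate_bijective`). [cite: Mochizuki2012, Ex 3.4 (i) p.80] -/
def dilate (μ : PosReal) : unitDisc →* unitDisc where
  toFun z := ⟨((ArchFrd.dilate μ (Units.mk0 (z : ℂ) (mem_unitDisc.1 z.2).1) : ℂˣ) : ℂ),
    dilate_mem μ (u := Units.mk0 (z : ℂ) (mem_unitDisc.1 z.2).1) (by rw [Units.val_mk0]; exact z.2)⟩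
  map_one' := Subtype.ext (by
    change (((ArchFrd.dilate μ (Units.mk0 ((1 : unitDisc) : ℂ) _)) : ℂˣ) : ℂ) = 1
    have h1 : Units.mk0 ((1 : unitDisc) : ℂ) (mem_unitDisc.1 (1 : unitDisc).2).1 = 1 := Units.ext rfl
    rw [h1, map_one, Units.val_one])
  map_mul' z w := Subtype.ext (by
    change (((ArchFrd.dilate μ (Units.mk0 ((z * w : unitDisc) : ℂ) _)) : ℂˣ) : ℂ) =
      ((ArchFrd.dilate μ (Units.mk0 (z : ℂ) _) : ℂˣ) : ℂ) * ((ArchFrd.dilate μ (Units.mk0 (w : ℂ) _) : ℂˣ) : ℂ)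
    have hzw : Units.mk0 ((z * w : unitDisc) : ℂ) (mem_unitDisc.1 (z * w).2).1 =
        Units.mk0 (z : ℂ) (mem_unitDisc.1 z.2).1 * Units.mk0 (w : ℂ) (mem_unitDisc.1 w.2).1 := Units.ext rfl
    rw [hzw, map_mul, Units.val_mul])

/-- `D_μ` on `𝒪^▷_ℂ`, underlying complex number. [cite: Mochizuki2012, Ex 3.4 (i) p.80] -/
theorem coe_dilate (μ : PosReal) (z : unitDisc) :
    ((dilate μ z : unitDisc) : ℂ) = ((ArchFrd.dilate μ (Units.mk0 (z : ℂ) (mem_unitDisc.1 z.2).1) : ℂˣ) : ℂ) := rfl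

/-- `D_{1/μ} ∘ D_μ = id` on `𝒪^▷_ℂ`. [cite: Mochizuki2012, Ex 3.4 (i) p.80] -/
theorem dilate_inv_dilate (μ : PosReal) (z : unitDisc) : dilate μ⁻¹ (dilate μ z) = z := by
  apply Subtype.ext
  change (((ArchFrd.dilate μ⁻¹ (Units.mk0 ((dilate μ z : unitDisc) : ℂ) (mem_unitDisc.1 (dilate μ z).2).1)) : ℂˣ) : ℂ) = (z : ℂ)
  have h : Units.mk0 ((dilate μ z : unitDisc) : ℂ) (mem_unitDisc.1 (dilate μ z).2).1 = ArchFrd.dilate μ (Units.mk0 (z : ℂ) (mem_unitDisc.1 z.2).1) :=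
    Units.ext rfl
  rw [h, ArchFrd.dilate_inv_dilate, Units.val_mk0]

/-- `D_μ ∘ D_{1/μ} = id` on `𝒪^▷_ℂ`. [cite: Mochizuki2012, Ex 3.4 (i) p.80] -/
theorem dilate_dilate_inv (μ : PosReal) (z : unitDisc) : dilate μ (dilate μ⁻¹ z) = z := by
  have h := dilate_inv_dilate μ⁻¹ z
  rwa [inv_inv] at h

/-- `D_μ` is bijective on `𝒪^▷_ℂ`. [cite: Mochizuki2012, Ex 3.4 (i) p.80] -/
theorem dilate_bijective (μ : PosReal) : Function.Bijective (dilate μ) :=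
  ⟨Function.LeftInverse.injective (dilate_inv_dilate μ), Function.RightInverse.surjective (dilate_dilate_inv μ)⟩

/-- `D_μ` of a positive real `r ∈ (0, 1]` is `r^μ`. [cite: MochizukiAbsTopIII2015, Remark 5.8.1 p.142] -/
theorem coe_dilate_of_pos (μ : PosReal) (z : unitDisc) {r : ℝ} (hr : 0 < r) (hz : (z : ℂ) = (r : ℂ)) :
    ((dilate μ z : unitDisc) : ℂ) = ((r ^ (μ : ℝ) : ℝ) : ℂ) := by
  have hu : Units.mk0 (z : ℂ) (mem_unitDisc.1 z.2).1 = ofPosReal ℂ ⟨r, hr⟩ := Units.ext (by rw [Units.val_mk0, hz, coe_ofPosReal]; rfl)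
  rw [coe_dilate, hu, ArchFrd.dilate_apply, unitPart_ofPosReal, absHom_ofPosReal, Units.val_mul, OneMemClass.coe_one, Units.val_one, one_mul,
    coe_ofPosReal]
  rfl

/-- **`D_μ` carries the splitting `(0, 1] = 𝒪^▷_ℂ ∩ ℝ_{>0}` onto itself**: `z ∈ (0,1] ↔ D_μ z ∈ (0,1]`.
[cite: MochizukiAbsTopIII2015, Remark 5.8.1 p.142] -/
theorem dilate_mem_posReal_iff (μ : PosReal) (z : unitDisc) :
    (∃ r : ℝ, 0 < r ∧ r ≤ 1 ∧ ((dilate μ z : unitDisc) : ℂ) = (r : ℂ)) ↔ (∃ r : ℝ, 0 < r ∧ r ≤ 1 ∧ (z : ℂ) = (r : ℂ)) := by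
  constructor
  · rintro ⟨r, hr, hr1, h⟩
    refine ⟨‖(z : ℂ)‖, norm_pos_iff.2 (mem_unitDisc.1 z.2).1, (mem_unitDisc.1 z.2).2, ?_⟩
    -- `z = D_{1/μ} (D_μ z) = D_{1/μ} r = r^{1/μ}`, a positive real, hence equal to its norm
    have hz : (z : ℂ) = ((r ^ ((μ⁻¹ : PosReal) : ℝ) : ℝ) : ℂ) := by
      rw [← dilate_inv_dilate μ z]; exact coe_dilate_of_pos μ⁻¹ (dilate μ z) hr h
    rw [hz, Complex.norm_real, Real.norm_of_nonneg (Real.rpow_nonneg hr.le _)]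
  · rintro ⟨r, hr, hr1, h⟩
    exact ⟨r ^ (μ : ℝ), Real.rpow_pos_of_pos hr _, Real.rpow_le_one hr.le hr1 μ.2.le, coe_dilate_of_pos μ z hr h⟩

end unitDisc

namespace Cpt

/-- **`𝒪^▷(std t) ⥲ 𝒪^▷_ℂ` intertwines the map induced by `Ψ_μ` with `D_μ`.** [cite: Mochizuki2012, Ex 3.4 (i) p.80] -/
theorem endEquivUnitDisc_dilateEnd (μ t : PosReal) (φ : PreFrobenioid.endSubmonoid (C.toElem ptBase) (std t)) :
    endEquivUnitDisc (PosReal.rpowEquiv μ t) (dilateEnd μ t φ) = unitDisc.dilate μ (endEquivUnitDisc t φ) := by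
  apply Subtype.ext
  rw [coe_endEquivUnitDisc_dilateEnd, unitDisc.coe_dilate]
  congr 2
  exact Units.ext (by rw [Units.val_mk0, coe_endEquivUnitDisc])

/-- The map induced by `Ψ_μ` on `𝒪^▷(std t)` is BIJECTIVE onto `𝒪^▷(std (t^μ))`. [cite: Mochizuki2012, Ex 3.4 (i) p.80] -/
theorem dilateEnd_bijective (μ t : PosReal) : Function.Bijective (dilateEnd μ t) := by
  have h : (dilateEnd μ t : _ → _) = (endEquivUnitDisc (PosReal.rpowEquiv μ t)).symm ∘ unitDisc.dilate μ ∘ endEquivUnitDisc t := by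
    funext φ
    apply (endEquivUnitDisc (PosReal.rpowEquiv μ t)).injective
    rw [Function.comp_apply, Function.comp_apply, MulEquiv.apply_symm_apply, endEquivUnitDisc_dilateEnd]
  rw [h]
  exact (endEquivUnitDisc _).symm.bijective.comp ((unitDisc.dilate_bijective μ).comp (endEquivUnitDisc t).bijective)

/-- **The map induced by `Ψ_μ` carries the splitting `τ⊢ = (0, 1]` (read through `𝒪^▷(std −) ⥲ 𝒪^▷_ℂ`) onto itself.**
[cite: MochizukiAbsTopIII2015, Remark 5.8.1 p.142] -/
theorem dilateEnd_mem_posReal_iff (μ t : PosReal) (φ : PreFrobenioid.endSubmonoid (C.toElem ptBase) (std t)) :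
    (∃ r : ℝ, 0 < r ∧ r ≤ 1 ∧ ((endEquivUnitDisc (PosReal.rpowEquiv μ t) (dilateEnd μ t φ) : unitDisc) : ℂ) = (r : ℂ)) ↔
      (∃ r : ℝ, 0 < r ∧ r ≤ 1 ∧ ((endEquivUnitDisc t φ : unitDisc) : ℂ) = (r : ℂ)) := by
  rw [endEquivUnitDisc_dilateEnd]
  exact unitDisc.dilate_mem_posReal_iff μ _

/-! ### §4. At the pseudo-terminal object `std 1` of [IUTchI] Ex 3.4 (i): `Ψ_μ` as a self-map of `𝒪^▷(std 1)` -/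

/-- `1^μ = 1`. [cite: MochizukiFrdII2008, Def 3.1 (ii) p.23] -/
theorem _root_.Literature.AlgebraicGeometry.Frobenioids.ArchFrd.PosReal.rpowEquiv_one (μ : PosReal) : PosReal.rpowEquiv μ 1 = 1 :=
  map_one _

/-- Transport of `𝒪^▷(std t)` along an equality of tips (the identity when `t = t'` definitionally). [cite: Mochizuki2012, Ex 3.4 (i) p.80] -/
def endCongr {t t' : PosReal} (h : t = t') :
    PreFrobenioid.endSubmonoid (C.toElem ptBase) (std t) ≃* PreFrobenioid.endSubmonoid (C.toElem ptBase) (std t') := by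
  subst h
  exact MulEquiv.refl _

/-- `endCongr` does not change the underlying arrow (up to the retyping `std t = std t'`). [cite: Mochizuki2012, Ex 3.4 (i) p.80] -/
theorem heq_coe_endCongr {t t' : PosReal} (h : t = t') (φ : PreFrobenioid.endSubmonoid (C.toElem ptBase) (std t)) :
    HEq ((endCongr h φ : PreFrobenioid.endSubmonoid (C.toElem ptBase) (std t')) : End (std t')) (φ.1 : End (std t)) := by
  subst h
  rfl

/-- `endCongr` does not change the scalar. [cite: Mochizuki2012, Ex 3.4 (i) p.80] -/
theorem endEquivUnitDisc_endCongr {t t' : PosReal} (h : t = t') (φ : PreFrobenioid.endSubmonoid (C.toElem ptBase) (std t)) :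
    endEquivUnitDisc t' (endCongr h φ) = endEquivUnitDisc t φ := by
  subst h
  rfl

/-- **`Ψ_μ` on `𝒪^▷(𝒞_v) := 𝒪^▷(std 1)`** ([IUTchI] Ex 3.4 (i)'s monoid at the pseudo-terminal object of tip `1`, `Ψ_μ (std 1) = std (1^μ) = std 1`):
the composite of `dilateEnd μ 1` with the transport along `1^μ = 1`. [cite: Mochizuki2012, Ex 3.4 (i) p.80] -/
def dilateEndOne (μ : PosReal) :
    PreFrobenioid.endSubmonoid (C.toElem ptBase) (std 1) →* PreFrobenioid.endSubmonoid (C.toElem ptBase) (std 1) :=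
  (endCongr (PosReal.rpowEquiv_one μ)).toMonoidHom.comp (dilateEnd μ 1)

/-- `Ψ_μ (std 1) = std 1`. [cite: Mochizuki2012, Ex 3.4 (i) p.80] -/
theorem dilateFunctor_obj_std_one (μ : PosReal) : (C.dilateFunctor ptBase μ).obj (std 1) = std 1 := by
  change std (PosReal.rpowEquiv μ 1) = std 1
  rw [PosReal.rpowEquiv_one]

/-- `dilateEndOne μ φ` IS `Ψ_μ φ` (up to the retyping `Ψ_μ (std 1) = std 1`). [cite: Mochizuki2012, Ex 3.4 (i) p.80] -/
theorem heq_coe_dilateEndOne (μ : PosReal) (φ : PreFrobenioid.endSubmonoid (C.toElem ptBase) (std 1)) :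
    HEq ((dilateEndOne μ φ : PreFrobenioid.endSubmonoid (C.toElem ptBase) (std 1)) : End (std 1))
      ((C.dilateFunctor ptBase μ).map (φ.1 : std 1 ⟶ std 1)) :=
  heq_coe_endCongr (PosReal.rpowEquiv_one μ) (dilateEnd μ 1 φ)

/-- **Through `𝒪^▷(std 1) ⥲ 𝒪^▷_ℂ`, `Ψ_μ` is the dilation `D_μ`.** [cite: MochizukiAbsTopIII2015, Remark 5.8.1 p.142] -/
theorem endEquivUnitDisc_dilateEndOne (μ : PosReal) (φ : PreFrobenioid.endSubmonoid (C.toElem ptBase) (std 1)) :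
    endEquivUnitDisc 1 (dilateEndOne μ φ) = unitDisc.dilate μ (endEquivUnitDisc 1 φ) := by
  rw [← endEquivUnitDisc_dilateEnd μ 1 φ]
  exact endEquivUnitDisc_endCongr (PosReal.rpowEquiv_one μ) (dilateEnd μ 1 φ)

/-- `Ψ_μ` on `𝒪^▷(std 1)` is bijective. [cite: Mochizuki2012, Ex 3.4 (i) p.80] -/
theorem dilateEndOne_bijective (μ : PosReal) : Function.Bijective (dilateEndOne μ) :=
  (endCongr (PosReal.rpowEquiv_one μ)).bijective.comp (dilateEnd_bijective μ 1)

/-- **`Ψ_μ` on `𝒪^▷(std 1)` as a multiplicative AUTOMORPHISM.** [cite: Mochizuki2012, Ex 3.4 (i) p.80] -/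
def dilateEndOneEquiv (μ : PosReal) :
    PreFrobenioid.endSubmonoid (C.toElem ptBase) (std 1) ≃* PreFrobenioid.endSubmonoid (C.toElem ptBase) (std 1) :=
  MulEquiv.ofBijective (dilateEndOne μ) (dilateEndOne_bijective μ)

/-- The automorphism is `dilateEndOne`. [cite: Mochizuki2012, Ex 3.4 (i) p.80] -/
@[simp] theorem dilateEndOneEquiv_apply (μ : PosReal) (φ : PreFrobenioid.endSubmonoid (C.toElem ptBase) (std 1)) :
    dilateEndOneEquiv μ φ = dilateEndOne μ φ := rfl

/-- **`Ψ_μ` carries the splitting `(0, 1] ⊆ 𝒪^▷_ℂ ≅ 𝒪^▷(std 1)` onto itself.** [cite: MochizukiAbsTopIII2015, Remark 5.8.1 p.142] -/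
theorem dilateEndOne_mem_posReal_iff (μ : PosReal) (φ : PreFrobenioid.endSubmonoid (C.toElem ptBase) (std 1)) :
    (∃ r : ℝ, 0 < r ∧ r ≤ 1 ∧ ((endEquivUnitDisc 1 (dilateEndOne μ φ) : unitDisc) : ℂ) = (r : ℂ)) ↔
      (∃ r : ℝ, 0 < r ∧ r ≤ 1 ∧ ((endEquivUnitDisc 1 φ : unitDisc) : ℂ) = (r : ℂ)) := by
  rw [endEquivUnitDisc_dilateEndOne]
  exact unitDisc.dilate_mem_posReal_iff μ _

end Cpt

end ArchFrd

end Literature.AlgebraicGeometry.Frobenioids
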